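import Literature.Computability.QuantumComplexity.ZXCalculusCongruence
import HarnessLib

/-!
# `ZX_{π/4}`-diagrams modulo the calculus: the quotient `ZXClass n m`

Topic `Literature/Computability/QuantumComplexity`, continuing `ZXCalculus.lean` /
`ZXCalculusCongruence.lean`; layer A2 of the formalisation of Jeandel–Perdrix–Vilmart's
completeness theorem (`JeandelPerdrixVilmart2018_completeness`). Inter-derivability `D ⇌ D'`
(`ZXEquivalent`) is a congruence, so diagrams of type `n → m` modulo `ZX_{π/4}` form a type
`ZXClass n m := ZXDiagram n m ⧸ ⇌` on which the two compositions are well defined and every axiom of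
the calculus is an EQUALITY — so that later derivations are chains of `rw`/`simp` in arbitrary
contexts, and `D ⇌ D'` is recovered as `mk D = mk D'` (`mk_eq_mk`). In categorical terms
(`ZXClass`, `⨟`, `⊠`, `mk (wires n)`, `mk swap`) is the PROP presented by the generators and the
rules (Selinger 2010, §3–4); we do not package it as a Mathlib category here.

* `ZXClass n m`, `ZXClass.mk`, `mk_eq_mk : mk D = mk E ↔ D ⇌ E`, `sound`, induction principles
  `ind`, `ind₂`, `ind₃`;
* lifted operations `A ⨟ B` (`seq`), `A ⊠ B` (`par`), `cast`, `transpose`, `colorSwap`, computing on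
  representatives (`mk_seq_mk`, …, all `rfl`; the `simp` normal form `mk_seq`/`mk_par` splits classes
  of composite terms into composites of classes);
* the structural axioms as equalities: `seq_assoc`, `id_seq`, `seq_id`, `par_assoc`, `empty_par`,
  `par_empty`, `interchange`, `wires_par_wires`, `swap_seq_swap`, `swap_nat`; derived sliding laws
  `par_eq_seq_left`, `par_eq_seq_right`, `slide`; the bent-wire axioms `snake_left`, …; and
  `ZXDiagram.Rule.eq : Rule l r → mk l = mk r` for the whole table;
* casts on classes: `cast_rfl`, `cast_id`, `cast_cast`, `cast_seq_cast`, `cast_par_cast`, `mk_cast`.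

## References

* E. Jeandel, S. Perdrix, R. Vilmart, LICS 2018 (arXiv:1705.11151v2), §2.2 [JeandelPerdrixVilmart2018].
* P. Selinger, *A survey of graphical languages for monoidal categories* (2010), §3–4 [Selinger2010].
-/

noncomputable section

namespace Literature.Computability.QuantumComplexity

open ZXDiagram

variable {n m k l n' m' k' n'' m'' : ℕ}

/-- **Diagrams modulo the calculus**: `ZXDiagram n m` quotiented by inter-derivability `⇌` in
`ZX_{π/4}` (the hom-sets of the PROP presented by JPV's generators and rules). [cite: JeandelPerdrixVilmart2018, §2.2] -/
def ZXClass (n m : ℕ) : Type := Quotient (ZXDiagram.instSetoid n m)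

namespace ZXClass

/-- The class of a diagram. [folklore] -/
def mk (D : ZXDiagram n m) : ZXClass n m := Quotient.mk _ D

/-- Inter-derivable diagrams have equal classes. [folklore] -/
theorem sound {D E : ZXDiagram n m} (h : D ⇌ E) : mk D = mk E := Quotient.sound h

/-- Equal classes are inter-derivable diagrams. [folklore] -/
theorem exact {D E : ZXDiagram n m} (h : mk D = mk E) : D ⇌ E := Quotient.exact h

/-- **Equality of classes is inter-derivability.** [folklore] -/
theorem mk_eq_mk {D E : ZXDiagram n m} : mk D = mk E ↔ D ⇌ E := ⟨exact, sound⟩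

/-- `mk` is surjective. [folklore] -/
theorem mk_surjective : Function.Surjective (mk : ZXDiagram n m → ZXClass n m) :=
  Quotient.mk_surjective

/-- Induction on a class: it suffices to treat representatives. [folklore] -/
@[elab_as_elim] protected theorem ind {p : ZXClass n m → Prop} (h : ∀ D, p (mk D)) (A : ZXClass n m) :
    p A := Quotient.ind h A

/-- Induction on two classes. [folklore] -/
@[elab_as_elim] protected theorem ind₂ {p : ZXClass n m → ZXClass n' m' → Prop}
    (h : ∀ D E, p (mk D) (mk E)) (A : ZXClass n m) (B : ZXClass n' m') : p A B :=
  Quotient.inductionOn₂ A B h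

/-- Induction on three classes. [folklore] -/
@[elab_as_elim] protected theorem ind₃ {p : ZXClass n m → ZXClass n' m' → ZXClass n'' m'' → Prop}
    (h : ∀ D E F, p (mk D) (mk E) (mk F)) (A : ZXClass n m) (B : ZXClass n' m') (C : ZXClass n'' m'') :
    p A B C :=
  Quotient.inductionOn₃ A B C h

/-! ### Lifted operations -/

/-- Sequential composition of classes (well defined by `ZXEquivalent.seq_congr`). [cite: JeandelPerdrixVilmart2018, §2.2] -/
def seq (A : ZXClass n m) (B : ZXClass m k) : ZXClass n k :=
  Quotient.liftOn₂ A B (fun a b => mk (a ⨾ b)) fun _ _ _ _ ha hb => sound (ZXEquivalent.seq_congr ha hb)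

/-- Spatial composition of classes (well defined by `ZXEquivalent.par_congr`). [cite: JeandelPerdrixVilmart2018, §2.2] -/
def par (A : ZXClass n m) (B : ZXClass n' m') : ZXClass (n + n') (m + m') :=
  Quotient.liftOn₂ A B (fun a b => mk (a ⊗ b)) fun _ _ _ _ ha hb => sound (ZXEquivalent.par_congr ha hb)

/-- `A ⨟ B`: sequential composition of classes, `A` then `B`. -/
scoped[Literature.Computability.QuantumComplexity] notation:60 A:60 " ⨟ " B:61 =>
  (ZXClass.seq (A :) (B :) :)
/-- `A ⊠ B`: spatial composition of classes, `A` on the first wires. -/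
scoped[Literature.Computability.QuantumComplexity] notation:70 A:70 " ⊠ " B:71 =>
  (ZXClass.par (A :) (B :) :)

/-- Transport of a class along equal wire counts. [folklore] -/
def cast (A : ZXClass n m) (hn : n = n') (hm : m = m') : ZXClass n' m' := hn ▸ hm ▸ A

/-- The upside-down flip of a class (well defined by `ZXEquivalent.transpose`). [cite: JeandelPerdrixVilmart2018, Fig. 1] -/
def transpose (A : ZXClass n m) : ZXClass m n :=
  Quotient.liftOn A (fun a => mk a.transpose) fun _ _ h => sound (ZXEquivalent.transpose h)

/-- The colour swap of a class (well defined by `ZXEquivalent.colorSwap`). [cite: JeandelPerdrixVilmart2018, Fig. 1] -/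
def colorSwap (A : ZXClass n m) : ZXClass n m :=
  Quotient.liftOn A (fun a => mk a.colorSwap) fun _ _ h => sound (ZXEquivalent.colorSwap h)

/-- `⨟` computes on representatives. [folklore] -/
theorem mk_seq_mk (A : ZXDiagram n m) (B : ZXDiagram m k) : mk A ⨟ mk B = mk (A ⨾ B) := rfl

/-- `⊠` computes on representatives. [folklore] -/
theorem mk_par_mk (A : ZXDiagram n m) (B : ZXDiagram n' m') : mk A ⊠ mk B = mk (A ⊗ B) := rfl

/-- The class of a sequential composition splits (the `simp` normal form takes classes of
composite terms apart, so that the class-level axioms apply to the pieces). [folklore] -/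
@[simp] theorem mk_seq (A : ZXDiagram n m) (B : ZXDiagram m k) : mk (A ⨾ B) = mk A ⨟ mk B := rfl

/-- The class of a spatial composition splits. [folklore] -/
@[simp] theorem mk_par (A : ZXDiagram n m) (B : ZXDiagram n' m') : mk (A ⊗ B) = mk A ⊠ mk B := rfl

/-- `cast` computes on representatives. [folklore] -/
theorem mk_cast (D : ZXDiagram n m) (hn : n = n') (hm : m = m') :
    mk (D.cast hn hm) = (mk D).cast hn hm := by
  subst hn hm; rfl

/-- `transpose` computes on representatives. [folklore] -/
@[simp] theorem transpose_mk (D : ZXDiagram n m) : (mk D).transpose = mk D.transpose := rfl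

/-- `colorSwap` computes on representatives. [folklore] -/
@[simp] theorem colorSwap_mk (D : ZXDiagram n m) : (mk D).colorSwap = mk D.colorSwap := rfl

/-! ### Casts of classes -/

/-- Casting along `rfl` is the identity. [folklore] -/
@[simp] theorem cast_rfl (A : ZXClass n m) : A.cast rfl rfl = A := rfl

/-- A cast along reflexive equalities, however proved, is the identity (useful when the two wire
counts are only definitionally equal, e.g. `0 + 2` and `2`). [folklore] -/
theorem cast_id (A : ZXClass n m) (hn : n = n) (hm : m = m) : A.cast hn hm = A := rfl

/-- Casts compose. [folklore] -/
@[simp] theorem cast_cast (A : ZXClass n m) (hn : n = n') (hm : m = m') (hn' : n' = n'')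
    (hm' : m' = m'') : (A.cast hn hm).cast hn' hm' = A.cast (hn.trans hn') (hm.trans hm') := by
  subst hn hm hn' hm'; rfl

/-- Composing casts along a common middle cast. [folklore] -/
theorem cast_seq_cast (A : ZXClass n m) (B : ZXClass m k) (hn : n = n') (hm : m = m')
    (hk : k = k') : A.cast hn hm ⨟ B.cast hm hk = (A ⨟ B).cast hn hk := by
  subst hn hm hk; rfl

/-- A spatial composition of casts is a cast. [folklore] -/
theorem cast_par_cast (A : ZXClass n m) (B : ZXClass n' m') {p q p' q' : ℕ} (hn : n = p)
    (hm : m = q) (hn' : n' = p') (hm' : m' = q') :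
    A.cast hn hm ⊠ B.cast hn' hm' = (A ⊠ B).cast (by rw [hn, hn']) (by rw [hm, hm']) := by
  subst hn hm hn' hm'; rfl

/-- Casts are injective. [folklore] -/
theorem cast_inj {A B : ZXClass n m} (hn : n = n') (hm : m = m') :
    A.cast hn hm = B.cast hn hm ↔ A = B := by
  subst hn hm; exact Iff.rfl

/-- Moving a cast to the other side of an equation. [folklore] -/
theorem cast_eq_iff {A : ZXClass n m} {B : ZXClass n' m'} (hn : n = n') (hm : m = m') :
    A.cast hn hm = B ↔ A = B.cast hn.symm hm.symm := by
  subst hn hm; exact Iff.rfl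

/-- The flip of a cast. [folklore] -/
theorem transpose_cast (A : ZXClass n m) (hn : n = n') (hm : m = m') :
    (A.cast hn hm).transpose = A.transpose.cast hm hn := by
  subst hn hm; rfl

/-! ### Every axiom is an equality of classes -/

/-- An axiom `Rule l r` gives `mk l = mk r`. [cite: JeandelPerdrixVilmart2018, §2.2] -/
theorem _root_.Literature.Computability.QuantumComplexity.ZXDiagram.Rule.eq {l r : ZXDiagram n m}
    (h : Rule l r) : mk l = mk r := sound h.zx

/-- The flip is an involution on classes. [folklore] -/
@[simp] theorem transpose_transpose (A : ZXClass n m) : A.transpose.transpose = A := by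
  induction A using ZXClass.ind with
  | h D => simp

/-- The colour swap is an involution on classes. [folklore] -/
@[simp] theorem colorSwap_colorSwap (A : ZXClass n m) : A.colorSwap.colorSwap = A := by
  induction A using ZXClass.ind with
  | h D => simp

/-- The flip reverses `⨟`. [folklore] -/
@[simp] theorem transpose_seq (A : ZXClass n m) (B : ZXClass m k) :
    (A ⨟ B).transpose = B.transpose ⨟ A.transpose := by
  induction A, B using ZXClass.ind₂ with
  | h D E => rfl

/-- The flip distributes over `⊠`. [folklore] -/
@[simp] theorem transpose_par (A : ZXClass n m) (B : ZXClass n' m') :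
    (A ⊠ B).transpose = A.transpose ⊠ B.transpose := by
  induction A, B using ZXClass.ind₂ with
  | h D E => rfl

/-- The colour swap distributes over `⨟`. [folklore] -/
@[simp] theorem colorSwap_seq (A : ZXClass n m) (B : ZXClass m k) :
    (A ⨟ B).colorSwap = A.colorSwap ⨟ B.colorSwap := by
  induction A, B using ZXClass.ind₂ with
  | h D E => rfl

/-- The colour swap distributes over `⊠`. [folklore] -/
@[simp] theorem colorSwap_par (A : ZXClass n m) (B : ZXClass n' m') :
    (A ⊠ B).colorSwap = A.colorSwap ⊠ B.colorSwap := by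
  induction A, B using ZXClass.ind₂ with
  | h D E => rfl

/-- The flip is injective on classes. [folklore] -/
theorem transpose_inj {A B : ZXClass n m} : A.transpose = B.transpose ↔ A = B :=
  ⟨fun h => by rw [← transpose_transpose A, h, transpose_transpose], fun h => h ▸ rfl⟩

/-- The colour swap is injective on classes. [folklore] -/
theorem colorSwap_inj {A B : ZXClass n m} : A.colorSwap = B.colorSwap ↔ A = B :=
  ⟨fun h => by rw [← colorSwap_colorSwap A, h, colorSwap_colorSwap], fun h => h ▸ rfl⟩

/-! ### The strict symmetric monoidal structure -/

/-- Associativity of `⨟`. [folklore] -/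
theorem seq_assoc (A : ZXClass n m) (B : ZXClass m k) (C : ZXClass k l) :
    (A ⨟ B) ⨟ C = A ⨟ (B ⨟ C) := by
  induction A, B, C using ZXClass.ind₃ with
  | h D E F => exact (Rule.seq_assoc D E F).eq

/-- Left unit of `⨟`. [folklore] -/
@[simp] theorem id_seq (A : ZXClass n m) : mk (wires n) ⨟ A = A := by
  induction A using ZXClass.ind with
  | h D => exact (Rule.id_seq D).eq

/-- Right unit of `⨟`. [folklore] -/
@[simp] theorem seq_id (A : ZXClass n m) : A ⨟ mk (wires m) = A := by
  induction A using ZXClass.ind with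
  | h D => exact (Rule.seq_id D).eq

/-- Associativity of `⊠` (a cast aligns `(n + n') + n''` with `n + (n' + n'')`). [folklore] -/
theorem par_assoc (A : ZXClass n m) (B : ZXClass n' m') (C : ZXClass n'' m'') :
    (A ⊠ B) ⊠ C = (A ⊠ (B ⊠ C)).cast (Nat.add_assoc n n' n'').symm (Nat.add_assoc m m' m'').symm := by
  induction A, B, C using ZXClass.ind₃ with
  | h D E F => rw [mk_par_mk, mk_par_mk, mk_par_mk, mk_par_mk, ← mk_cast]; exact (Rule.par_assoc D E F).eq

/-- Associativity of `⊠`, the cast on the other side. [folklore] -/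
theorem par_assoc' (A : ZXClass n m) (B : ZXClass n' m') (C : ZXClass n'' m'') :
    A ⊠ (B ⊠ C) = ((A ⊠ B) ⊠ C).cast (Nat.add_assoc n n' n'') (Nat.add_assoc m m' m'') := by
  rw [par_assoc, cast_cast, cast_rfl]

/-- Left unit of `⊠` (a cast aligns `0 + n` with `n`). [folklore] -/
theorem empty_par (A : ZXClass n m) :
    mk (wires 0) ⊠ A = A.cast (Nat.zero_add n).symm (Nat.zero_add m).symm := by
  induction A using ZXClass.ind with
  | h D => rw [mk_par_mk, ← mk_cast]; exact (Rule.empty_par D).eq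

/-- Right unit of `⊠`. [folklore] -/
@[simp] theorem par_empty (A : ZXClass n m) : A ⊠ mk (wires 0) = A := by
  induction A using ZXClass.ind with
  | h D => exact (Rule.par_empty D).eq

/-- The interchange law. [folklore] -/
theorem interchange (A : ZXClass n m) (B : ZXClass m k) (C : ZXClass n' m') (D : ZXClass m' k') :
    (A ⊠ C) ⨟ (B ⊠ D) = (A ⨟ B) ⊠ (C ⨟ D) := by
  induction A, B using ZXClass.ind₂ with
  | h a b =>
    induction C, D using ZXClass.ind₂ with
    | h c d => exact (Rule.interchange a b c d).eq

/-- Identities tensor: `𝕀^{⊗n} ⊗ 𝕀^{⊗m} = 𝕀^{⊗(n+m)}`. [folklore] -/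
@[simp] theorem wires_par_wires (n m : ℕ) : mk (wires n) ⊠ mk (wires m) = mk (wires (n + m)) :=
  (Rule.id_par_id n m).eq

/-- The crossing is an involution. [folklore] -/
@[simp] theorem swap_seq_swap : mk swap ⨟ mk swap = mk (wires 2) := Rule.swap_swap.eq

/-- Naturality of the crossing of one wire over a block: `(A ⊗ 𝕀) ⨾ χ = χ ⨾ (𝕀 ⊗ A)`. [folklore] -/
theorem swap_nat (A : ZXClass n m) :
    (A ⊠ mk (wires 1)) ⨟ mk (bswap1 m) = mk (bswap1 n) ⨟ (mk (wires 1) ⊠ A) := by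
  induction A using ZXClass.ind with
  | h D => exact (Rule.swap_nat D).eq

/-- Sliding: a spatial composition is "first factor, then second factor". [folklore] -/
theorem par_eq_seq_left (A : ZXClass n m) (B : ZXClass n' m') :
    A ⊠ B = (A ⊠ mk (wires n')) ⨟ (mk (wires m) ⊠ B) := by
  rw [interchange, seq_id, id_seq]

/-- Sliding: a spatial composition is "second factor, then first factor". [folklore] -/
theorem par_eq_seq_right (A : ZXClass n m) (B : ZXClass n' m') :
    A ⊠ B = (mk (wires n) ⊠ B) ⨟ (A ⊠ mk (wires m')) := by
  rw [interchange, seq_id, id_seq]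

/-- Sliding two spatially separated diagrams past each other. [folklore] -/
theorem slide (A : ZXClass n m) (B : ZXClass n' m') :
    (A ⊠ mk (wires n')) ⨟ (mk (wires m) ⊠ B) = (mk (wires n) ⊠ B) ⨟ (A ⊠ mk (wires m')) := by
  rw [← par_eq_seq_left, ← par_eq_seq_right]

/-- `⊠` with identities commutes with `⨟` on the left factor. [folklore] -/
theorem seq_par_wires (A : ZXClass n m) (B : ZXClass m k) (p : ℕ) :
    (A ⨟ B) ⊠ mk (wires p) = (A ⊠ mk (wires p)) ⨟ (B ⊠ mk (wires p)) := by
  rw [interchange, seq_id]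

/-- `⊠` with identities commutes with `⨟` on the right factor. [folklore] -/
theorem wires_par_seq (p : ℕ) (A : ZXClass n m) (B : ZXClass m k) :
    mk (wires p) ⊠ (A ⨟ B) = (mk (wires p) ⊠ A) ⨟ (mk (wires p) ⊠ B) := by
  rw [interchange, seq_id]

/-! ### The bent-wire axioms ("only topology matters") as equalities -/

/-- Snake equation, cup on the right. [cite: JeandelPerdrixVilmart2018, §2.2] -/
@[simp] theorem snake_left : (mk (wires 1) ⊠ mk cup) ⨟ (mk cap ⊠ mk (wires 1)) = mk (wires 1) :=
  Rule.snake_left.eq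

/-- Snake equation, cup on the left. [cite: JeandelPerdrixVilmart2018, §2.2] -/
@[simp] theorem snake_right : (mk cup ⊠ mk (wires 1)) ⨟ (mk (wires 1) ⊠ mk cap) = mk (wires 1) :=
  Rule.snake_right.eq

/-- The cup is symmetric. [cite: JeandelPerdrixVilmart2018, §2.2] -/
@[simp] theorem cup_swap : mk cup ⨟ mk swap = mk cup := Rule.cup_swap.eq

/-- The cap is symmetric. [cite: JeandelPerdrixVilmart2018, §2.2] -/
@[simp] theorem swap_cap : mk swap ⨟ mk cap = mk cap := Rule.swap_cap.eq

/-- The phase-free three-legged green spider is commutative. [cite: JeandelPerdrixVilmart2018, §2.2] -/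
@[simp] theorem swap_spider : mk swap ⨟ mk (Z 2 1 0) = mk (Z 2 1 0) := Rule.spider_comm.eq

/-- Leg-bending of the phase-free three-legged green spider. [cite: JeandelPerdrixVilmart2018, §2.2] -/
theorem spider_bend : (mk cup ⊠ mk (wires 1)) ⨟ (mk (wires 1) ⊠ mk (Z 2 1 0)) = mk (Z 1 2 0) :=
  Rule.spider_bend.eq

end ZXClass

end Literature.Computability.QuantumComplexity
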